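import Summits.KontsevichZagierPeriods.KontsevichZagierPeriods.Theorems.FurushoPentagonDoubleShuffleInKZIntegralSeriesAlgebra
import Summits.KontsevichZagierPeriods.KontsevichZagierPeriods.Theorems.FurushoPentagonDoubleShuffleInKZIntegralSeriesShuffle

/-!
# `DoubleShuffleInKZ` (stmt-KontsevichZagierPeriods-14665, route `FurushoPentagon`) follows from — and
# contains — the Kaneko–Yamamoto integral–series identities with `l = (1,…,1)`

Helper file (`--supports stmt-KontsevichZagierPeriods-14665`), third of three (harmonic algebra in
`…IntegralSeriesAlgebra.lean`, shuffle side in `…IntegralSeriesShuffle.lean`).  THE REDUCTION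
(`doubleShuffleInKZ_of_integralSeriesFamily`): if, for every `Z` pinned to Kontsevich's simplex classes,
every admissible `u = (b+1) t` (`b ≥ 1`; tree convention: first entry `≥ 2`; `x v = binaryWord u`) and
every `j ≥ 1`,

  `Σ_{w ∈ yʲ ш v} Z(x w) − Σ_{c ∈ (1^{j+1})⋆} Σ_{w ∈ t ∗ c.tail} Z((b + c₁) w) ∈ KZ.relations`   (IS_j(u))

— the identity `ζ(μ(k, (1^{j+1}))) = ζ(k ⊛ ((1^{j+1}))⋆)` of [KanekoYamamoto2018, Thm 4.1] for
`k` = the reversed index `u` with its last entry lowered by one, written out in the tree's vocabulary: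
left, the integral over the `V`-shaped 2-poset "comb of `k` and a chain of `j` bullets joined at the top
`∘`" dissected into its linear extensions `x (yʲ ш v)`; right, its evaluation as a zeta-star type sum over
the compositions `c` of `j + 1` (`MZV.starIndices`) — then the route's deliverable `DoubleShuffleInKZ`
holds.  Chain: `doubleShuffleInKZ_of_regularisedFamily` (it suffices to get IKZ's family (v)
`Σ_{u ∈ s ∗ 1ˡ} ⟨ψ, reg_ш u⟩ = 0` [IharaKanekoZagier2006, Thm 2 (v)]); the leading-ones decomposition of
`s ∗ 1ˡ`; `⟨ψ, reg_ш(yⁱ x v)⟩ = (-1)ⁱ Σ_{w ∈ yⁱ ш v} ψ(x w)` (`pair_shuffleReg_binaryWord`, IKZ Cor. 5);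
the hypothesis pushed through the realisation `χ`; and the formal identity `delta_identity`.
THE CONVERSE (`integralSeriesFamily_of_regularisedFamily`, realisation form): IKZ's family (v) gives back
every `IS_j(u)` under `χ` (triangular induction on `j`), so with `regularisedFamily_of_doubleShuffleInKZ`
the family is EXACTLY the content of the deliverable.  `IS_1(u)` is Hoffman's relation ((v) at `l = 1`,
PROVED in the tree); what is NOT in the tree is `IS_j` for `j ≥ 2` — ONE `V`-poset per `(u, j)`, the
natural target of `j` dilation-homotopy levers of the `HoffmanRelationInKZ` line followed by an `h_j`-type
harmonic dissection.

References: M. Kaneko, S. Yamamoto, *A new integral–series identity of multiple zeta values and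
regularizations*, Selecta Math. 24 (2018), Thm 4.1, Thm 4.6, Prop. 5.4; K. Ihara, M. Kaneko, D. Zagier,
Compos. Math. 142 (2006), Thm 2 (v), Cor. 5; S. Yamamoto, *Multiple zeta-star values and multiple
integrals*, RIMS Kôkyûroku Bessatsu B68 (2017) (2-posets).
-/

noncomputable section

open scoped BigOperators

namespace Summit.KontsevichZagierPeriods.FurushoPentagon.DoubleShuffleInKZ.IntegralSeries

open Literature.NumberTheory.Transcendental
open Literature.NumberTheory.Transcendental.MZV (starIndices sumStuffle)
open Summit.KontsevichZagierPeriods.KontsevichZagierPeriods.Theses.FurushoPentagon (DoubleShuffleInKZ)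

/-! ### The reduction of the route item to the integral–series family -/

/-- **`DoubleShuffleInKZ` from the Kaneko–Yamamoto integral–series family.** Suppose that for every
assignment `Z` pinned to Kontsevich's simplex classes, every admissible index `u = (b+1, t)` (`b ≥ 1`)
and every `j ≥ 1` the identity of [KanekoYamamoto2018, Thm 4.1] for `k = (reversed u with last entry
lowered by one)` and `l = (1^{j+1})`, in the tree's conventions
`Σ_{w ∈ yʲ ш v} Z(x w) = Σ_{c ∈ (1^{j+1})⋆} Σ_{w ∈ t ∗ c.tail} Z((b + c₁) w)` (`x v = binaryWord u`;
left: the `V`-shaped 2-poset integral dissected into its linear extensions; right: its series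
evaluation, a sum of zeta-star type over the compositions `c` of `j + 1`), holds as a move chain
(`∈ KZ.relations`). Then the route's deliverable `DoubleShuffleInKZ` holds: by
`doubleShuffleInKZ_of_regularisedFamily` it suffices to derive IKZ's family (v)
`Σ_{u ∈ s ∗ 1ˡ} ⟨ψ, reg_ш u⟩ = 0`; decompose `s ∗ 1ˡ` by leading ones
(`sumStuffle_cons_replicate_one_eq`), evaluate `⟨ψ, reg_ш(yⁱ x v)⟩ = (-1)ⁱ Σ_{w ∈ yⁱ ш v} ψ(x w)`
(`pair_shuffleReg_binaryWord`, IKZ Cor. 5), substitute the hypothesis through the realisation `χ`,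
and conclude by the formal identity `delta_identity` (telescoping + the `e`–`h` cancellation in the
harmonic algebra). No finite double shuffle, regularisation map `ρ` or structure theorem
`𝔥¹ = 𝔥⁰[y]` is used: the family ALONE gives (v) (a `T = 0` sharpening of
[KanekoYamamoto2018, Thm 4.6 / Prop. 5.4]). [cite: KanekoYamamoto2018, Thm 4.1, Thm 4.6, Prop. 5.4] -/
theorem doubleShuffleInKZ_of_integralSeriesFamily
    (hIS : ∀ Z : List ℕ → KZ.FormalRep,
      (∀ (u : List ℕ) (hu : MZV.IsAdmissible u), Z u = KZ.of (KZ.mzvRep u hu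
        (KZ.mzvIntegrand_isSemialgebraicFunOn_holds u) (KZ.mzvIntegrand_integrableOn_holds u hu))) →
      ∀ (b : ℕ) (t : List ℕ), MZV.IsAdmissible ((b + 1) :: t) → ∀ j : ℕ, 1 ≤ j →
        ((MZV.shuffleWord (List.replicate j true) (MZV.binaryWord ((b + 1) :: t)).tail).map
            fun w => Z (MZV.ofBinaryWord (false :: w))).sum -
          ((starIndices (List.replicate (j + 1) 1)).map fun c =>
            sumStuffle (fun w => Z ((b + c.headD 0) :: w)) t c.tail).sum ∈ KZ.relations) :
    DoubleShuffleInKZ := by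
  refine doubleShuffleInKZ_of_regularisedFamily fun R _ _ χ hrel _hmul _hunit Z hZ s hs hne l hl => ?_
  obtain ⟨a, t, rfl⟩ := List.exists_cons_of_ne_nil hne
  have ha : 2 ≤ a := by simpa using hs.2 (List.cons_ne_nil a t)
  obtain ⟨a', rfl⟩ : ∃ a', a = a' + 1 := ⟨a - 1, by omega⟩
  obtain ⟨L, rfl⟩ : ∃ L, l = L + 1 := ⟨l - 1, by omega⟩
  have ht1 : ∀ x ∈ t, 1 ≤ x := fun x hx => hs.1 x (List.mem_cons_of_mem _ hx)
  -- KEY: `⟨ψ, reg_ш(binaryWord (1ⁱ (b+1) t'))⟩ = (-1)ⁱ F i b t'` for `b ≥ 1`, `t'` positive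
  have hG : ∀ (i b : ℕ), 1 ≤ b → ∀ t' : List ℕ, (∀ x ∈ t', 1 ≤ x) →
      Shuffle.pair (fun v => if MZV.IsConvergentWord v then χ (Z (MZV.ofBinaryWord v)) else 0)
          (MZV.shuffleReg (MZV.binaryWord (List.replicate i 1 ++ (b + 1) :: t'))) =
        (-1 : R) ^ i * ((starIndices (List.replicate (i + 1) 1)).map fun c =>
          sumStuffle (fun w => χ (Z ((b + c.headD 0) :: w))) t' c.tail).sum := by
    intro i b hb t' ht'
    rw [pair_shuffleReg_binaryWord χ Z i b hb t']
    congr 1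
    rcases Nat.eq_zero_or_pos i with rfl | hi
    · rw [shuffleSide_zero (fun idx => χ (Z idx)) b hb t' ht']
      exact (starSide_zero (fun idx => χ (Z idx)) b t').symm
    have hadm : MZV.IsAdmissible ((b + 1) :: t') :=
      ⟨fun x hx => by
        rcases List.mem_cons.mp hx with rfl | hx
        · omega
        · exact ht' x hx, fun _ => by simp only [List.head_cons]; omega⟩
    have key := hrel _ (hIS Z hZ b t' hadm i hi)
    rw [map_sub, sub_eq_zero, map_list_sum, map_list_sum, List.map_map, List.map_map] at key
    simp only [Function.comp_def, map_sumStuffle] at key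
    exact key
  -- assemble: the goal is IKZ's family (v) for `s = (a'+1) t`, `l = L + 1`
  show sumStuffle (fun u => Shuffle.pair
      (fun v => if MZV.IsConvergentWord v then χ (Z (MZV.ofBinaryWord v)) else 0)
      (MZV.shuffleReg (MZV.binaryWord u))) ((a' + 1) :: t) (List.replicate (L + 1) 1) = 0
  rw [sumStuffle_cons_replicate_one_eq]
  have hpos : ∀ (m : ℕ), ∀ t' ∈ MZV.stuffle t (List.replicate m 1), ∀ x ∈ t', 1 ≤ x :=
    fun m t' ht' => MZV.one_le_of_mem_stuffle t _ ht1 (fun x hx => by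
      rw [List.eq_of_mem_replicate hx]) t' ht'
  have h1 : ∀ i : ℕ, sumStuffle ((fun u => Shuffle.pair
      (fun v => if MZV.IsConvergentWord v then χ (Z (MZV.ofBinaryWord v)) else 0)
      (MZV.shuffleReg (MZV.binaryWord u))) ∘
      (List.replicate i 1 ++ ·) ∘ List.cons (a' + 1)) t (List.replicate (L + 1 - i) 1) =
      (-1 : R) ^ i * sumStuffle (fun t' => ((starIndices (List.replicate (i + 1) 1)).map fun c =>
          sumStuffle ((fun idx => χ (Z idx)) ∘ List.cons (a' + c.headD 0)) t' c.tail).sum) t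
        (List.replicate (L + 1 - i) 1) := by
    intro i
    rw [← sumStuffle_mul_left]
    exact sumStuffle_congr fun t' ht' => hG i a' (by omega) t' (hpos _ t' ht')
  have h2 : ∀ i : ℕ, sumStuffle ((fun u => Shuffle.pair
      (fun v => if MZV.IsConvergentWord v then χ (Z (MZV.ofBinaryWord v)) else 0)
      (MZV.shuffleReg (MZV.binaryWord u))) ∘
      (List.replicate i 1 ++ ·) ∘ List.cons (a' + 1 + 1)) t (List.replicate (L + 1 - 1 - i) 1) =
      (-1 : R) ^ i * sumStuffle (fun t' => ((starIndices (List.replicate (i + 1) 1)).map fun c =>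
          sumStuffle ((fun idx => χ (Z idx)) ∘ List.cons (a' + 1 + c.headD 0)) t' c.tail).sum) t
        (List.replicate (L - i) 1) := by
    intro i
    rw [← sumStuffle_mul_left, show L + 1 - 1 - i = L - i by omega]
    exact sumStuffle_congr fun t' ht' => hG i (a' + 1) (by omega) t' (hpos _ t' ht')
  simp only [h1, h2]
  exact delta_identity (fun idx => χ (Z idx)) a' t L

/-! ### The converse: the deliverable contains the integral–series family -/

/-- **IKZ's family (v) implies the integral–series family, in every realisation** (converse of
`doubleShuffleInKZ_of_integralSeriesFamily`, triangular in `j`): if `Σ_{u ∈ s ∗ 1ˡ} ⟨ψ, reg_ш u⟩ = 0`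
for all non-empty admissible `s` and `l ≥ 1` (for a realisation `χ` and a pinned `Z`), then for every
admissible `u = (b+1) t` and `j ≥ 1`,
`Σ_{w ∈ yʲ ш v} χ Z(x w) = Σ_{c ∈ (1^{j+1})⋆} Σ_{w ∈ t ∗ c.tail} χ Z((b + c₁) w)`: in the family at
`(s, l) = (u, j)` the only term not covered by the induction hypothesis is `(-1)ʲ ⟨ψ, reg_ш(yʲ x v)⟩`,
and `delta_identity` is the same equation with the integral–series value in its place.  With
`regularisedFamily_of_doubleShuffleInKZ` this shows that the family `IS_j(u)` is EXACTLY the content of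
the deliverable `DoubleShuffleInKZ` (in realisation form). [cite: KanekoYamamoto2018, Thm 4.6] -/
theorem integralSeriesFamily_of_regularisedFamily {R : Type} [CommRing R] [Algebra ℚ R]
    (χ : KZ.FormalRep →+ R) (Z : List ℕ → KZ.FormalRep)
    (hV : ∀ s : List ℕ, MZV.IsAdmissible s → s ≠ [] → ∀ l : ℕ, 1 ≤ l →
      ((MZV.stuffle s (List.replicate l 1)).map fun u =>
        (MZV.shuffleReg (MZV.binaryWord u)).sum fun v a =>
          a • (if MZV.IsConvergentWord v then χ (Z (MZV.ofBinaryWord v)) else (0 : R))).sum = 0) :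
    ∀ (j : ℕ), 1 ≤ j → ∀ (b : ℕ) (t : List ℕ), MZV.IsAdmissible ((b + 1) :: t) →
      ((MZV.shuffleWord (List.replicate j true) (MZV.binaryWord ((b + 1) :: t)).tail).map
          fun w => χ (Z (MZV.ofBinaryWord (false :: w)))).sum =
        ((starIndices (List.replicate (j + 1) 1)).map fun c =>
          sumStuffle (fun w => χ (Z ((b + c.headD 0) :: w))) t c.tail).sum := by
  -- strong induction on `j`
  suffices H : ∀ n j : ℕ, 1 ≤ j → j ≤ n → ∀ (b : ℕ) (t : List ℕ), MZV.IsAdmissible ((b + 1) :: t) →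
      ((MZV.shuffleWord (List.replicate j true) (MZV.binaryWord ((b + 1) :: t)).tail).map
          fun w => χ (Z (MZV.ofBinaryWord (false :: w)))).sum =
        ((starIndices (List.replicate (j + 1) 1)).map fun c =>
          sumStuffle (fun w => χ (Z ((b + c.headD 0) :: w))) t c.tail).sum from
    fun j hj => H j j hj le_rfl
  intro n
  induction n with
  | zero => intro j hj hjn; omega
  | succ n ih =>
    intro j hj hjn b t hbt
    rcases Nat.lt_or_ge j (n + 1) with hlt | hge
    · exact ih j hj (by omega) b t hbt
    obtain rfl : j = n + 1 := le_antisymm hjn hge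
    have hb : 1 ≤ b := by have := hbt.2 (List.cons_ne_nil _ _); simp at this; omega
    have ht1 : ∀ x ∈ t, 1 ≤ x := fun x hx => hbt.1 x (List.mem_cons_of_mem _ hx)
    have hpos : ∀ (m : ℕ), ∀ t' ∈ MZV.stuffle t (List.replicate m 1), ∀ x ∈ t', 1 ≤ x :=
      fun m t' ht' => MZV.one_le_of_mem_stuffle t _ ht1 (fun x hx => by
        rw [List.eq_of_mem_replicate hx]) t' ht'
    -- below `j = n + 1`: the evaluated shuffle side is the integral–series value (induction)
    have hG : ∀ i : ℕ, i ≤ n → ∀ b' : ℕ, 1 ≤ b' → ∀ t' : List ℕ, (∀ x ∈ t', 1 ≤ x) →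
        Shuffle.pair (fun v => if MZV.IsConvergentWord v then χ (Z (MZV.ofBinaryWord v)) else 0)
            (MZV.shuffleReg (MZV.binaryWord (List.replicate i 1 ++ (b' + 1) :: t'))) =
          (-1 : R) ^ i * ((starIndices (List.replicate (i + 1) 1)).map fun c =>
            sumStuffle (fun w => χ (Z ((b' + c.headD 0) :: w))) t' c.tail).sum := by
      intro i hi b' hb' t' ht'
      rw [pair_shuffleReg_binaryWord χ Z i b' hb' t']
      congr 1
      rcases Nat.eq_zero_or_pos i with rfl | hi0
      · rw [shuffleSide_zero (fun idx => χ (Z idx)) b' hb' t' ht']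
        exact (starSide_zero (fun idx => χ (Z idx)) b' t').symm
      exact ih i hi0 hi b' t' ⟨fun x hx => by
        rcases List.mem_cons.mp hx with rfl | hx
        · omega
        · exact ht' x hx, fun _ => by simp only [List.head_cons]; omega⟩
    -- the family at `(s, l) = ((b+1) t, n+1)`, decomposed by leading ones
    have hfam := hV ((b + 1) :: t) hbt (List.cons_ne_nil _ _) (n + 1) (by omega)
    change sumStuffle (fun u => Shuffle.pair
      (fun v => if MZV.IsConvergentWord v then χ (Z (MZV.ofBinaryWord v)) else 0)
      (MZV.shuffleReg (MZV.binaryWord u))) ((b + 1) :: t) (List.replicate (n + 1) 1) = 0 at hfam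
    rw [sumStuffle_cons_replicate_one_eq, Finset.sum_range_succ] at hfam
    -- the top term `i = n + 1` is `(-1)^{n+1}` times the shuffle side
    simp only [Nat.sub_self, List.replicate_zero, MZV.sumStuffle_nil_right, Function.comp_apply] at hfam
    rw [pair_shuffleReg_binaryWord χ Z (n + 1) b hb t] at hfam
    have h1 : ∀ i ∈ Finset.range (n + 1), sumStuffle ((fun u => Shuffle.pair
        (fun v => if MZV.IsConvergentWord v then χ (Z (MZV.ofBinaryWord v)) else 0)
        (MZV.shuffleReg (MZV.binaryWord u))) ∘
        (List.replicate i 1 ++ ·) ∘ List.cons (b + 1)) t (List.replicate (n + 1 - i) 1) =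
        (-1 : R) ^ i * sumStuffle (fun t' => ((starIndices (List.replicate (i + 1) 1)).map fun c =>
            sumStuffle ((fun idx => χ (Z idx)) ∘ List.cons (b + c.headD 0)) t' c.tail).sum) t
          (List.replicate (n + 1 - i) 1) := by
      intro i hi
      rw [Finset.mem_range] at hi
      rw [← sumStuffle_mul_left]
      exact sumStuffle_congr fun t' ht' => hG i (by omega) b hb t' (hpos _ t' ht')
    have h2 : ∀ i ∈ Finset.range (n + 1), sumStuffle ((fun u => Shuffle.pair
        (fun v => if MZV.IsConvergentWord v then χ (Z (MZV.ofBinaryWord v)) else 0)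
        (MZV.shuffleReg (MZV.binaryWord u))) ∘
        (List.replicate i 1 ++ ·) ∘ List.cons (b + 1 + 1)) t (List.replicate (n + 1 - 1 - i) 1) =
        (-1 : R) ^ i * sumStuffle (fun t' => ((starIndices (List.replicate (i + 1) 1)).map fun c =>
            sumStuffle ((fun idx => χ (Z idx)) ∘ List.cons (b + 1 + c.headD 0)) t' c.tail).sum) t
          (List.replicate (n - i) 1) := by
      intro i hi
      rw [Finset.mem_range] at hi
      rw [← sumStuffle_mul_left, show n + 1 - 1 - i = n - i by omega]
      exact sumStuffle_congr fun t' ht' => hG i (by omega) (b + 1) (by omega) t' (hpos _ t' ht')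
    rw [Finset.sum_congr rfl h1, Finset.sum_congr rfl h2] at hfam
    -- `delta_identity` is the same equation with the integral–series value as top term
    have hδ := delta_identity (fun idx => χ (Z idx)) b t n
    rw [Finset.sum_range_succ] at hδ
    simp only [Nat.sub_self, List.replicate_zero, MZV.sumStuffle_nil_right] at hδ
    simp only [Function.comp_def] at hfam hδ ⊢
    -- subtract and cancel the unit `(-1)^{n+1}`
    have hunit : IsUnit ((-1 : R) ^ (n + 1)) := (isUnit_one.neg).pow _
    refine hunit.mul_right_injective ?_
    simp only
    linear_combination hfam - hδ
end Summit.KontsevichZagierPeriods.FurushoPentagon.DoubleShuffleInKZ.IntegralSeries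

end
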